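import Mathlib.Topology.Algebra.ContinuousMonoidHom
import Mathlib.Algebra.BigOperators.Intervals
import Mathlib.Algebra.BigOperators.Ring.Finset
import Mathlib.Data.Real.Basic
import Mathlib.Tactic.Ring
import HarnessLib

/-!
# Joshi, *Arithmetic Teichmüller Spaces IV* (arXiv:2403.10430v2) §4.5 «Idelic Tate divisors» (eqs. (4.5.1)–(4.5.10),
# Prop. 4.5.11, Prop. 4.5.12, Rmk. 4.5.13) — TYPED over an interim arithmeticoid-indexed carrier

Record file of the abc-iut cell, branch E «type Joshi's construction, test vs S» (rung LADDER-ABC:A2.E; seat abc-iut-E-t27,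
slot T-27, `HOME/plan/E/t27/INVENTORY.tsv`). **No side is taken** on [IUTchIII] Cor. 3.12, on Joshi's claims, or on Mochizuki's
reports on them; the source is an unrefereed arXiv preprint («Preliminary version for comments»); TYPED ≠ PROVED ≠ ENDORSED.
Locators «p.N l.M» = line M of page file `pNNNN.txt` of the render `HOME/lit/renders/Joshi-arxiv-2403.10430/` (v2). OBJECT file
(plan/E/E-PLAN.md R14): imports Mathlib / Literature only, binds no frozen `Cor312*`/`Thm311*` decl (nearest ones are NAMED in
docstrings). «disputed» in the claim tags is the registered status word recording that a dispute about the series exists in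
print (Mochizuki's Report 2024-03) — nothing else.

CONTENT ([J-IV] §4.5, p.42 l.71 – p.45 l.45). «The key idea in the proof of Theorem 7.1.1 is to average over Tate divisors … of
an elliptic curve C/L with respect to many distinct arithmetic holomorphic structures or holomorphoids C/arith(L)» (p.42
l.72–74). Everything in the section — the Tate idele `TI_{C/arith(L)} = (q_v)_v` ((4.5.1)–(4.5.2)), the tuple `TI^j =
(q_v^{j²})_v` ((4.5.3)–(4.5.4)), its divisor `= q_{C/L}` ((4.5.5)), the theta-values divisor ((4.5.6)), the Kummer completions
`L̃*_v ≃ H^1(G_{L_v}, ℚ_{p_v}(1))`, `∏_v L̃*_v = H^1(arith(L), ℚ(1))` and the classes `T̃I` ((4.5.7)–(4.5.10)), the collated set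
`Ψ_{C,A}` of Prop. 4.5.11 and the function `z ↦ log(TI_{C/arith(L)_z})` of Prop. 4.5.12 — depends on the arithmeticoid
`z ∈ 𝒴_L` ([Joshi 2023a] = arXiv:2305.10398; not in tree or Mathlib), so the section is typed over an INTERIM abstract carrier
`TateIdeleDatum` (plan/E/ASSIGNMENTS.md §0.3; merge-debts: `𝒴_L` = slot T-37 `Joshi/Arithmeticoids.lean`; the Tate divisor
`q_M`, arithmetic divisors and `log(·)` of §4.2–§4.4 = slot T-26 `Joshi/ATS4Differents.lean`). Prop. 4.5.11 («there exists a
subset … which consists of …», proof: «immediate … [Joshi, 2023a, Proposition 7.5.1]») is a CONSTRUCTION, typed as the def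
`collatedTateClasses` (nearest frozen object `Cor312.Setting.possibleImages`, the [J-IV] shadow of [J-III] Prop. 9.7.5.1 —
named, not bound); Prop. 4.5.12's NON-CONSTANCY is the one ASSERTED claim of §4.5 (`TateDegreeNonConstant`, tagged); the
kernel lemma `tateDegree_eq_of_indep` only LOCATES what non-constancy requires of the datum (that `ord_v(q_v)` or «log v» vary
with `z`; cf. [J-IV] Thm. 3.3.1 / Rmk. 3.3.2 p.37 l.1–6) — no side. Rmk. 4.5.13 (1), (3)–(7) (p.45 l.1–45: volumes of `Ψ_{C,A}`,
Bloch–Kato `H^1_e` and Mochizuki's tensor-product log-shell `𝓘_Mochizuki` = [J-III] §9, [IUTchIV] Prop. 1.4, the heuristic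
integrals over `𝒴_L` / `Σ′_L`) are locator-only; (2) is `tateClass_std_mem`. The companion file `Joshi/ATS4LogDiffConductor.lean`
types §4.6. Deliberately NOT here: any `Cor312*`/`Thm311*` binding (R14), the arithmeticoids themselves (T-37), §4.1–§4.4 (T-26).
No `sorry`, axiom, instance, notation, or new `Prop` fact. [claim: Joshi2024ATS4, status: disputed].
-/

noncomputable section

namespace Summit.ABC.IUTFork.Joshi.ATS4

/-! ## Tate ideles over the arithmeticoid-indexed interim carrier ([J-IV] §4.5) -/

/-- **Interim carrier for [J-IV] §4.5** (p.42 l.74 – p.43 l.72). Parameters: `Y` = Joshi's `𝒴_L` (arithmeticoids of `L`,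
[Joshi 2023a]); `V` = `V^non_L`; `K z v` = «`L_v^*`» as provided by the arithmeticoid `z` (a multiplicative group); `H z v` =
«`L̃*_v ≃ H^1(G_{L_v}, ℚ_{p_v}(1))`» ((4.5.7)–(4.5.8)), a topological abelian group. Fields: the standard arithmeticoid `y₀`
(p.44 l.7–8), the semistable support `V ⊂ V_L` ((4.5.2), finite), `[L:ℚ]`, the valuations `ord_v`, a CHOICE of Tate
parameter `q_v` at each `v` (used on `V` only), the Kummer maps ((4.5.10) «a compatible system q̃_v of p_v^n-roots of q_v
provides an element» of `L̃*_v`), and «log v» as computed in the normalised arithmeticoid `arith(L)^nor_z` (p.44 l.24–26).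
SIGNATURE only — nothing asserted; nearest frozen object: the q-pilot Kummer datum `qK` of `Cor312Vol.PinnedRegions`
(analogue, not bound here). [claim: Joshi2024ATS4, status: disputed] -/
structure TateIdeleDatum (Y V : Type) [DecidableEq V] (K : Y → V → Type) [∀ z v, CommGroup (K z v)]
    (H : Y → V → Type) [∀ z v, AddCommGroup (H z v)] [∀ z v, TopologicalSpace (H z v)] where
  /-- the standard arithmeticoid `y₀ ∈ 𝒴_L` (p.44 l.7–8; [J-IV] §4.1 p.37 l.10–13) -/
  std : Y
  /-- the semistable support `V ⊂ V^non_L` of (4.5.2) (the primes of `f_L = (q_L)_red`, §4.4), a finite set -/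
  bad : Finset V
  /-- `[L : ℚ]` (denominator of the normalised degree (4.2.2)) -/
  degQ : ℕ
  /-- `[L : ℚ] ≥ 1` -/
  degQ_pos : 0 < degQ
  /-- `ord_v : L_v^* → ℤ` in the arithmeticoid `z` ((4.5.5) «Σ_v ord_v(q_v)·v») -/
  ord : ∀ (z : Y) (v : V), K z v →* Multiplicative ℤ
  /-- a CHOICE of Tate parameter `q_v ∈ L_v^*` of `C/arith(L)_z` at `v` ((4.5.2); only the values at `v ∈ V` are used) -/
  q : ∀ (z : Y) (v : V), K z v
  /-- the Kummer map `L_v^* → L̃*_v = H^1(G_{L_v}, ℚ_{p_v}(1))` ((4.5.7)–(4.5.10)) -/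
  kum : ∀ (z : Y) (v : V), K z v →* Multiplicative (H z v)
  /-- «log v», the logarithm of the residue cardinality at `v` as computed in the normalised arithmeticoid `arith(L)^nor_z`
  (§4.2 p.39 l.6–10; p.44 l.24–26) -/
  logN : Y → V → ℝ

namespace TateIdeleDatum

variable {Y V : Type} [DecidableEq V] {K : Y → V → Type} [∀ z v, CommGroup (K z v)] {H : Y → V → Type}
  [∀ z v, AddCommGroup (H z v)] [∀ z v, TopologicalSpace (H z v)] (D : TateIdeleDatum Y V K H)

/-- **The Tate idele** `TI_{C/arith(L)_z} = (q_v)_{v ∈ V^non_L} ∈ ∏_v L_v^*`, `q_v = 1` if `v ∉ V`, `q_v` = the chosen Tate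
parameter if `v ∈ V` ([J-IV] (4.5.1)–(4.5.2), p.42 l.77–88). [claim: Joshi2024ATS4, status: disputed] -/
def tateIdele (z : Y) : ∀ v : V, K z v := fun v => if v ∈ D.bad then D.q z v else 1

/-- **The tuple of Tate ideles** `TI^j_{C/arith(L)_z} = (q_v^{j²})_v`, `j = 1, …, ℓ*` ([J-IV] (4.5.3)–(4.5.4), p.42 l.89–105;
«I will continue to write TI = TI^1 interchangeably», p.43 l.1). [claim: Joshi2024ATS4, status: disputed] -/
def tateIdelePow (z : Y) (j : ℕ) : ∀ v : V, K z v := fun v => D.tateIdele z v ^ (j ^ 2)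

/-- `TI^1 = TI` (p.43 l.1). [claim: Joshi2024ATS4, status: disputed] -/
theorem tateIdelePow_one (z : Y) : D.tateIdelePow z 1 = D.tateIdele z := by
  funext v; simp [tateIdelePow]

/-- The divisor `Σ_v ord_v(x_v)·v` of an idele `x = (x_v)_v`, as its coefficient function `v ↦ ord_v(x_v)` ([J-IV] (4.5.5)
p.43 l.2–7; arithmetic divisors (4.2.1) are slot T-26's — merge-debt). [claim: Joshi2024ATS4, status: disputed] -/
def divisorOf (z : Y) (x : ∀ v : V, K z v) : V → ℤ := fun v => Multiplicative.toAdd (D.ord z v (x v))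

/-- **The Tate divisor** `q_{C/arith(L)_z} = Σ_{v ∈ V} ord_v(q_v)·v` ([J-IV] Def. 4.4.2 p.40 l.48–57, in the arithmeticoid `z`),
as a coefficient function supported on `V`. [claim: Joshi2024ATS4, status: disputed] -/
def tateDivisor (z : Y) : V → ℤ := fun v => if v ∈ D.bad then Multiplicative.toAdd (D.ord z v (D.q z v)) else 0

/-- **(4.5.5)** «the arithmetic divisor associated to TI_{C/arith(L)} is none other than the Tate divisor q_{C/arith(L)}»
(p.43 l.2–13): `Divisor(TI_z) = q_{C/arith(L)_z}`. DERIVED from the signature. [claim: Joshi2024ATS4, status: disputed] -/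
theorem divisorOf_tateIdele (z : Y) : D.divisorOf z (D.tateIdele z) = D.tateDivisor z := by
  funext v
  by_cases hv : v ∈ D.bad <;> simp [divisorOf, tateIdele, tateDivisor, hv]

/-- «different choices of TI_{C/arith(L)} provide the same Tate divisor» (p.43 l.11–12): two Tate-parameter choices that differ
by elements of valuation `0` («well defined up to multiplication by a local unit», Def. 4.4.2 p.40 l.50–51) have the same divisor.
DERIVED (the unit hypothesis is explicit). [claim: Joshi2024ATS4, status: disputed] -/
theorem divisorOf_eq_of_units (z : Y) (x y : ∀ v : V, K z v) (h : ∀ v, D.ord z v (x v / y v) = 1) :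
    D.divisorOf z x = D.divisorOf z y := by
  funext v
  have hx : D.ord z v (x v) = D.ord z v (y v) := by
    have := h v
    rwa [map_div, div_eq_one] at this
  simp [divisorOf, hx]

/-- **(4.5.6)** the «divisor associated to the tuple of Theta-values in [IUTchIII]»: `Σ_{j=1}^{ℓ*} Divisor(TI^j_z) =
Σ_j Σ_v ord_v(q_v^{j²})·v` (p.43 l.14–33; «One is interested in bounding its degree. This is not directly possible at the
moment», l.33–34). Nearest frozen object: `Cor312.Setting.negLogTheta` (procession-normalised Θ-pilot log-volume) — analogue
only. [claim: Joshi2024ATS4, status: disputed] -/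
def thetaValuesDivisor (z : Y) (lstar : ℕ) : V → ℤ :=
  fun v => ∑ j ∈ Finset.Icc 1 lstar, D.divisorOf z (D.tateIdelePow z j) v

/-- (4.5.6) evaluated: `Σ_{j=1}^{ℓ*} Divisor(TI^j_z) = (Σ_{j=1}^{ℓ*} j²)·q_{C/arith(L)_z}` (since `ord_v(q_v^{j²}) = j²·ord_v(q_v)`).
DERIVED from the signature. [claim: Joshi2024ATS4, status: disputed] -/
theorem thetaValuesDivisor_eq (z : Y) (lstar : ℕ) (v : V) :
    D.thetaValuesDivisor z lstar v = (∑ j ∈ Finset.Icc 1 lstar, ((j : ℤ) ^ 2)) * D.tateDivisor z v := by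
  rw [thetaValuesDivisor, Finset.sum_mul]
  refine Finset.sum_congr rfl fun j _ => ?_
  have h := congrFun (D.divisorOf_tateIdele z) v
  simp only [divisorOf] at h ⊢
  rw [tateIdelePow, map_pow, toAdd_pow, h, nsmul_eq_mul]
  push_cast
  ring

/-- **The Tate idele class** `T̃I_{C/arith(L)_z} = (q̃_v)_v ∈ ∏_v L̃*_v = H^1(arith(L)_z, ℚ(1))` ([J-IV] (4.5.10), p.43
l.64–72; (4.5.9) «in the notation and terminology of [Joshi, 2023a, §7.2]»). Nearest frozen object: the Kummer isomorphisms
`Thm311.Column.kumLGP` — analogue only. [claim: Joshi2024ATS4, status: disputed] -/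
def tateClass (z : Y) : ∀ v : V, H z v := fun v => Multiplicative.toAdd (D.kum z v (D.tateIdele z v))

/-- **[J-IV] Proposition 4.5.11** (p.44 l.1–14), typed as the construction it describes: for `A ⊂ 𝒴_L`, the subset
`Ψ_{C,A} ⊆ H^1(arith(L)_{y₀}, ℚ(1))` «which consists of the union, over z ∈ A, of the images of [the classes T̃I_{C/arith(L)_z}]
under all the isomorphisms (of topological groups) of each factor of H^1(arith(L)_z, ℚ(1)) ≃ H^1(arith(L)_y, ℚ(1))» (proof
l.13–14: «immediate … [Joshi, 2023a, Proposition 7.5.1]»). Nearest frozen object: `Cor312.Setting.possibleImages` (union of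
images under all allowed isomorphisms; the [J-IV] shadow of [J-III] Prop. 9.7.5.1, dictionary row D-10) — NOT bound here
(R14). [claim: Joshi2024ATS4, status: disputed] -/
def collatedTateClasses (A : Set Y) : Set (∀ v : V, H D.std v) :=
  {x | ∃ z ∈ A, ∃ σ : ∀ v : V, H z v ≃ₜ+ H D.std v, x = fun v => σ v (D.tateClass z v)}

/-- Membership in `Ψ_{C,A}` unfolded (Prop. 4.5.11 as printed: `x ∈ Ψ_{C,A}` iff `x` is a factorwise topological-group-isomorphic
image of the class of some `z ∈ A`). [claim: Joshi2024ATS4, status: disputed] -/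
theorem mem_collatedTateClasses_iff (A : Set Y) (x : ∀ v : V, H D.std v) :
    x ∈ D.collatedTateClasses A ↔
      ∃ z ∈ A, ∃ σ : ∀ v : V, H z v ≃ₜ+ H D.std v, x = fun v => σ v (D.tateClass z v) :=
  Iff.rfl

/-- **[J-IV] Remark 4.5.13 (2)** (p.45 l.4–6): «If the standard arithmeticoid y₀ ∈ A, then one knows one element of Ψ_{C,A}
namely T̃I_{C/arith(L)_{y₀}}» (take the identity isomorphisms). DERIVED. [claim: Joshi2024ATS4, status: disputed] -/
theorem tateClass_std_mem (A : Set Y) (hA : D.std ∈ A) : D.tateClass D.std ∈ D.collatedTateClasses A :=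
  ⟨D.std, hA, fun v => ContinuousAddEquiv.refl (H D.std v), rfl⟩

/-- `Ψ_{C,A}` grows with `A` (evident from Prop. 4.5.11's «union over z ∈ A»). DERIVED. [claim: Joshi2024ATS4, status: disputed] -/
theorem collatedTateClasses_mono {A B : Set Y} (hAB : A ⊆ B) :
    D.collatedTateClasses A ⊆ D.collatedTateClasses B := by
  rintro x ⟨z, hz, σ, rfl⟩
  exact ⟨z, hAB hz, σ, rfl⟩

/-- **The normalised degree of the Tate idele** `log(TI_{C/arith(L)_z}) = (1/[L:ℚ])·Σ_{v ∈ V} ord_v(q_v)·log v` ([J-IV]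
Prop. 4.5.12 p.44 l.24–27 with (4.2.1)–(4.2.2) p.39 l.25–38 and (4.4.5) p.41 l.22–29; «log v» read in the normalised
arithmeticoid `arith(L)^nor_z`). [claim: Joshi2024ATS4, status: disputed] -/
def tateDegree (z : Y) : ℝ := (D.degQ : ℝ)⁻¹ * ∑ v ∈ D.bad, (D.tateDivisor z v : ℝ) * D.logN z v

/-- **[J-IV] Proposition 4.5.12, the asserted part** (p.44 l.27–33): «if one takes A = 𝒴_L, then one obtains a NON-CONSTANT
function "normalized degree of the Tate divisor" 𝒴_L → ℝ given by z ↦ log(TI_{C/arith(L)_z})» (proof l.33: «clear from the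
previous proposition»). Joshi's CLAIM as a reading predicate over the interim carrier; HYPOTHESIS, never asserted here.
[claim: Joshi2024ATS4, status: disputed] -/
@[claim "Joshi2024ATS4" "disputed"]
def TateDegreeNonConstant : Prop := ∃ z z' : Y, D.tateDegree z ≠ D.tateDegree z'

/-- LOCATION LEMMA (kernel triviality, no side taken): two arithmeticoids whose Tate parameters have the same valuations on `V`
and whose normalised residue logarithms agree on `V` have the same normalised Tate degree — so `TateDegreeNonConstant` requires
the datum to vary `ord_v(q_v)` or «log v» with `z` (cf. [J-IV] Thm. 3.3.1 / Rmk. 3.3.2 p.37 l.1–6 on `y ↦ |p|_{K_y}`).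
[claim: Joshi2024ATS4, status: disputed] -/
theorem tateDegree_eq_of_indep {z z' : Y} (hq : ∀ v ∈ D.bad, D.ord z v (D.q z v) = D.ord z' v (D.q z' v))
    (hN : ∀ v ∈ D.bad, D.logN z v = D.logN z' v) : D.tateDegree z = D.tateDegree z' := by
  unfold tateDegree
  congr 1
  refine Finset.sum_congr rfl fun v hv => ?_
  rw [hN v hv, show D.tateDivisor z v = D.tateDivisor z' v by simp [tateDivisor, hv, hq v hv]]

/-- Contrapositive of the location lemma: a datum in which neither `ord_v(q_v)` nor «log v» depends on the arithmeticoid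
does not satisfy `TateDegreeNonConstant`. Located, not adjudicated. [claim: Joshi2024ATS4, status: disputed] -/
theorem not_tateDegreeNonConstant_of_indep
    (hq : ∀ (z z' : Y), ∀ v ∈ D.bad, D.ord z v (D.q z v) = D.ord z' v (D.q z' v))
    (hN : ∀ (z z' : Y), ∀ v ∈ D.bad, D.logN z v = D.logN z' v) : ¬ D.TateDegreeNonConstant := by
  rintro ⟨z, z', h⟩
  exact h (D.tateDegree_eq_of_indep (hq z z') (hN z z'))

end TateIdeleDatum

end Summit.ABC.IUTFork.Joshi.ATS4

end
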